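import Summits.CriticalPhenomena.SAWScalingLimit.Theorems.LeftRightFKG.Negative.BoxDomain
import HarnessLib

/-!
# Negative knowledge on crux `LeftRightFKG`, part 6: the crux order is dominance of height functions

**`wind_nonneg_iff_wcross`**: for two walks `w₁ w₂ : G.Walk a b` of a lattice subgraph whose vertices lie
in a box `[X0,X1] × [Y0,Y1]`, the crux's relation `le w₁ w₂` — the lens loop `w₁·w₂⁻¹` (the `Set.IccExtend`
of `SimpleGraph.Walk.toCurve`) winds non-negatively about EVERY point of `ℂ` — holds iff
`wcross m k w₁ ≤ wcross m k w₂` for every face `(m,k)` of the box.  So the left–right order of the crux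
is exactly componentwise dominance of the integer "height functions" `(m,k) ↦ wcross m k γ` (signed
crossings of the upward probe from the face centre): a decidable, finite criterion (provers: this is the
form in which lattice/FKG-lattice-condition arguments can be run; refuters: the form in which finite
counterexamples are certified). [folklore]
-/

noncomputable section

open Real Set Complex Literature.Probability.LatticeModels Literature.Probability.RandomPlanarGeometry
  Literature.Topology.PlaneTopology

namespace Summit.CriticalPhenomena.SAWScalingLimit.Theorems.LeftRightFKG.Negative

/-! ## The crux's order is facewise dominance of crossing counts -/

section OrderCharacterisation

variable {G : SimpleGraph (Site 2)}

/-- Far points in a half-plane: to the right. [folklore] -/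
theorem exists_far_re_gt {B : ℝ} {z : ℂ} (hz : B < z.re) (M : ℝ) :
    ∃ w : ℂ, M < ‖w‖ ∧ segment ℝ z w ⊆ {y : ℂ | B < y.re} := by
  refine ⟨⟨max z.re 0 + |M| + 1, z.im⟩, ?_, ?_⟩
  · have h1 := abs_re_le_norm (⟨max z.re 0 + |M| + 1, z.im⟩ : ℂ)
    have h2 : (⟨max z.re 0 + |M| + 1, z.im⟩ : ℂ).re = max z.re 0 + |M| + 1 := rfl
    rw [h2, abs_of_nonneg (by have := le_max_right z.re 0; have := abs_nonneg M; linarith)] at h1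
    have := le_abs_self M; have := le_max_right z.re 0; linarith
  · intro y hy
    obtain ⟨hlo, -⟩ := re_mem_of_mem_segment hy
    have hm : min z.re (max z.re 0 + |M| + 1) = z.re :=
      min_eq_left (by have := le_max_left z.re 0; have := abs_nonneg M; linarith)
    rw [show (⟨max z.re 0 + |M| + 1, z.im⟩ : ℂ).re = max z.re 0 + |M| + 1 from rfl, hm] at hlo
    exact lt_of_lt_of_le hz hlo

/-- Far points in a half-plane: to the left. [folklore] -/
theorem exists_far_re_lt {B : ℝ} {z : ℂ} (hz : z.re < B) (M : ℝ) :
    ∃ w : ℂ, M < ‖w‖ ∧ segment ℝ z w ⊆ {y : ℂ | y.re < B} := by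
  refine ⟨⟨min z.re 0 - |M| - 1, z.im⟩, ?_, ?_⟩
  · have h1 := abs_re_le_norm (⟨min z.re 0 - |M| - 1, z.im⟩ : ℂ)
    have h2 : (⟨min z.re 0 - |M| - 1, z.im⟩ : ℂ).re = min z.re 0 - |M| - 1 := rfl
    rw [h2, abs_of_nonpos (by have := min_le_right z.re 0; have := abs_nonneg M; linarith)] at h1
    have := le_abs_self M; have := min_le_right z.re 0; linarith
  · intro y hy
    obtain ⟨-, hhi⟩ := re_mem_of_mem_segment hy
    have hm : max z.re (min z.re 0 - |M| - 1) = z.re :=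
      max_eq_left (by have := min_le_left z.re 0; have := abs_nonneg M; linarith)
    rw [show (⟨min z.re 0 - |M| - 1, z.im⟩ : ℂ).re = min z.re 0 - |M| - 1 from rfl, hm] at hhi
    exact lt_of_le_of_lt hhi hz

/-- Far points in a half-plane: above. [folklore] -/
theorem exists_far_im_gt {B : ℝ} {z : ℂ} (hz : B < z.im) (M : ℝ) :
    ∃ w : ℂ, M < ‖w‖ ∧ segment ℝ z w ⊆ {y : ℂ | B < y.im} := by
  refine ⟨⟨z.re, max z.im 0 + |M| + 1⟩, ?_, ?_⟩
  · have h1 := abs_im_le_norm (⟨z.re, max z.im 0 + |M| + 1⟩ : ℂ)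
    have h2 : (⟨z.re, max z.im 0 + |M| + 1⟩ : ℂ).im = max z.im 0 + |M| + 1 := rfl
    rw [h2, abs_of_nonneg (by have := le_max_right z.im 0; have := abs_nonneg M; linarith)] at h1
    have := le_abs_self M; have := le_max_right z.im 0; linarith
  · intro y hy
    obtain ⟨hlo, -⟩ := im_mem_of_mem_segment hy
    have hm : min z.im (max z.im 0 + |M| + 1) = z.im :=
      min_eq_left (by have := le_max_left z.im 0; have := abs_nonneg M; linarith)
    rw [show (⟨z.re, max z.im 0 + |M| + 1⟩ : ℂ).im = max z.im 0 + |M| + 1 from rfl, hm] at hlo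
    exact lt_of_lt_of_le hz hlo

/-- Far points in a half-plane: below. [folklore] -/
theorem exists_far_im_lt {B : ℝ} {z : ℂ} (hz : z.im < B) (M : ℝ) :
    ∃ w : ℂ, M < ‖w‖ ∧ segment ℝ z w ⊆ {y : ℂ | y.im < B} := by
  refine ⟨⟨z.re, min z.im 0 - |M| - 1⟩, ?_, ?_⟩
  · have h1 := abs_im_le_norm (⟨z.re, min z.im 0 - |M| - 1⟩ : ℂ)
    have h2 : (⟨z.re, min z.im 0 - |M| - 1⟩ : ℂ).im = min z.im 0 - |M| - 1 := rfl
    rw [h2, abs_of_nonpos (by have := min_le_right z.im 0; have := abs_nonneg M; linarith)] at h1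
    have := le_abs_self M; have := min_le_right z.im 0; linarith
  · intro y hy
    obtain ⟨-, hhi⟩ := im_mem_of_mem_segment hy
    have hm : max z.im (min z.im 0 - |M| - 1) = z.im :=
      max_eq_left (by have := min_le_left z.im 0; have := abs_nonneg M; linarith)
    rw [show (⟨z.re, min z.im 0 - |M| - 1⟩ : ℂ).im = min z.im 0 - |M| - 1 from rfl, hm] at hhi
    exact lt_of_le_of_lt hhi hz

/-- **A closed lattice polyline does not wind about face centres outside its bounding box.**
[folklore] -/
theorem wind_poly_probeL_eq_zero_of_not_mem (a : Site 2) (l : List (Site 2))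
    (hend : (polylineFrom (pt a) (l.map pt)).1 = pt a) {X0 X1 Y0 Y1 : ℤ}
    (hbox : ∀ x ∈ a :: l, (X0 ≤ x 0 ∧ x 0 ≤ X1) ∧ (Y0 ≤ x 1 ∧ x 1 ≤ Y1)) {m k : ℤ}
    (hmk : m < X0 ∨ X1 ≤ m ∨ k < Y0 ∨ Y1 ≤ k) :
    wind (fun t => (poly a l).extend t - probeL m k) = 0 := by
  set K : Set ℂ := {z | ((X0 : ℝ) ≤ z.re ∧ z.re ≤ X1) ∧ ((Y0 : ℝ) ≤ z.im ∧ z.im ≤ Y1)} with hKdef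
  have hKeq : K = ({z : ℂ | (X0 : ℝ) ≤ z.re} ∩ {z : ℂ | z.re ≤ X1}) ∩ ({z : ℂ | (Y0 : ℝ) ≤ z.im} ∩ {z : ℂ | z.im ≤ Y1}) := by
    ext z; simp only [hKdef, Set.mem_inter_iff, Set.mem_setOf_eq]
  have hK : IsClosed K := by
    rw [hKeq]
    exact ((isClosed_le continuous_const Complex.continuous_re).inter
      (isClosed_le Complex.continuous_re continuous_const)).inter
      ((isClosed_le continuous_const Complex.continuous_im).inter
      (isClosed_le Complex.continuous_im continuous_const))
  have hKc : Convex ℝ K := by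
    rw [hKeq]
    exact ((convex_halfSpace_re_ge _).inter (convex_halfSpace_re_le _)).inter
      ((convex_halfSpace_im_ge _).inter (convex_halfSpace_im_le _))
  have hmem : ∀ x ∈ a :: l, pt x ∈ K := fun x hx => by
    obtain ⟨⟨h1, h2⟩, h3, h4⟩ := hbox x hx
    simp only [hKdef, mem_setOf_eq, pt_re, pt_im]
    exact ⟨⟨by exact_mod_cast h1, by exact_mod_cast h2⟩, by exact_mod_cast h3, by exact_mod_cast h4⟩
  have hr : range (poly a l) ⊆ K :=
    range_poly_subset hKc a l (hmem a (by simp)) fun x hx => hmem x (by simp [hx])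
  have hz : probeL m k ∉ K := by
    simp only [hKdef, mem_setOf_eq, probeL_re, probeL_im, not_and_or, not_le]
    rcases hmk with h | h | h | h
    · left; left; have : (m : ℝ) + 1 ≤ X0 := by exact_mod_cast h
      linarith
    · left; right; have : (X1 : ℝ) ≤ m := by exact_mod_cast h
      linarith
    · right; left; have : (k : ℝ) + 1 ≤ Y0 := by exact_mod_cast h
      linarith
    · right; right; have : (Y1 : ℝ) ≤ k := by exact_mod_cast h
      linarith
  refine wind_poly_eq_zero_far a l hend hK hr hz fun M => ?_
  simp only [hKdef, mem_setOf_eq, not_and_or, not_le] at hz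
  rcases hz with (h | h) | (h | h)
  · obtain ⟨w, hw, hs⟩ := exists_far_re_lt h M
    exact ⟨w, hw, fun y hy hyK => absurd hyK.1.1 (not_le.2 (hs hy))⟩
  · obtain ⟨w, hw, hs⟩ := exists_far_re_gt h M
    exact ⟨w, hw, fun y hy hyK => absurd hyK.1.2 (not_le.2 (hs hy))⟩
  · obtain ⟨w, hw, hs⟩ := exists_far_im_lt h M
    exact ⟨w, hw, fun y hy hyK => absurd hyK.2.1 (not_le.2 (hs hy))⟩
  · obtain ⟨w, hw, hs⟩ := exists_far_im_gt h M
    exact ⟨w, hw, fun y hy hyK => absurd hyK.2.2 (not_le.2 (hs hy))⟩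

/-- The open unit face with lower-left corner `(m, k)`. [folklore] -/
def openFace (m k : ℤ) : Set ℂ := {z | ((m : ℝ) < z.re ∧ z.re < m + 1) ∧ ((k : ℝ) < z.im ∧ z.im < k + 1)}

/-- The open face as an intersection of four open half-planes. [folklore] -/
theorem openFace_eq (m k : ℤ) : openFace m k =
    ({z : ℂ | (m : ℝ) < z.re} ∩ {z : ℂ | z.re < m + 1}) ∩ ({z : ℂ | (k : ℝ) < z.im} ∩ {z : ℂ | z.im < k + 1}) := by
  ext z; simp only [openFace, Set.mem_inter_iff, Set.mem_setOf_eq]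

/-- Open faces are open. [folklore] -/
theorem isOpen_openFace (m k : ℤ) : IsOpen (openFace m k) := by
  rw [openFace_eq]
  exact ((isOpen_lt continuous_const Complex.continuous_re).inter
    (isOpen_lt Complex.continuous_re continuous_const)).inter
    ((isOpen_lt continuous_const Complex.continuous_im).inter
    (isOpen_lt Complex.continuous_im continuous_const))

/-- Open faces are convex. [folklore] -/
theorem convex_openFace (m k : ℤ) : Convex ℝ (openFace m k) := by
  rw [openFace_eq]
  exact ((convex_halfSpace_re_gt _).inter (convex_halfSpace_re_lt _)).inter
    ((convex_halfSpace_im_gt _).inter (convex_halfSpace_im_lt _))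

/-- The face centre lies in the open face. [folklore] -/
theorem probeL_mem_openFace (m k : ℤ) : probeL m k ∈ openFace m k := by
  simp only [openFace, mem_setOf_eq, probeL_re, probeL_im]
  refine ⟨⟨by linarith, by linarith⟩, by linarith, by linarith⟩

/-- The open segment from a point of the closed face to its centre lies in the open face. [folklore] -/
theorem openSegment_subset_openFace {z : ℂ} {m k : ℤ} (h0 : (m : ℝ) ≤ z.re) (h1 : z.re ≤ m + 1)
    (h2 : (k : ℝ) ≤ z.im) (h3 : z.im ≤ k + 1) : openSegment ℝ z (probeL m k) ⊆ openFace m k := by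
  rw [openSegment_eq_image_lineMap]
  rintro y ⟨t, ⟨ht0, ht1⟩, rfl⟩
  simp only [openFace, mem_setOf_eq, AffineMap.lineMap_apply_module, Complex.add_re, Complex.add_im,
    Complex.smul_re, Complex.smul_im, smul_eq_mul, probeL_re, probeL_im]
  refine ⟨⟨by nlinarith, by nlinarith⟩, by nlinarith, by nlinarith⟩

/-- Points of an open face have no integral coordinate. [folklore] -/
theorem not_int_of_mem_openFace {m k : ℤ} {y : ℂ} (hy : y ∈ openFace m k) :
    ¬ ((∃ n : ℤ, y.re = n) ∨ (∃ n : ℤ, y.im = n)) := by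
  obtain ⟨⟨h0, h1⟩, h2, h3⟩ := hy
  rintro (⟨n, hn⟩ | ⟨n, hn⟩)
  · rw [hn] at h0 h1
    have a1 : m < n := by exact_mod_cast h0
    have a2 : n < m + 1 := by exact_mod_cast h1
    omega
  · rw [hn] at h2 h3
    have a1 : k < n := by exact_mod_cast h2
    have a2 : n < k + 1 := by exact_mod_cast h3
    omega

/-- **The left–right relation of the crux is facewise dominance of crossing counts.** For two walks
with the same endpoints in a lattice subgraph, all of whose vertices lie in the box
`[X0, X1] × [Y0, Y1]`: the lens loop `w₁ · w₂⁻¹` (the crux's `Set.IccExtend` of `toCurve`) has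
non-negative winding number about EVERY point of the plane iff `wcross m k w₁ ≤ wcross m k w₂` for every
face `(m, k)` of the box. (`→`: `wcross_le_of_wind_nonneg`; `←`: points of the trace have the junk value
`0`, every other point is joined inside its closed face to the face centre off the trace, where the
winding number is `-(pathCross)` inside the box and `0` outside.) [folklore] -/
theorem wind_nonneg_iff_wcross (hG : ∀ x y, G.Adj x y → (zdGraph 2).Adj x y) {a b : Site 2}
    (w₁ w₂ : G.Walk a b) {X0 X1 Y0 Y1 : ℤ}
    (hb₁ : ∀ x ∈ w₁.support, (X0 ≤ x 0 ∧ x 0 ≤ X1) ∧ (Y0 ≤ x 1 ∧ x 1 ≤ Y1))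
    (hb₂ : ∀ x ∈ w₂.support, (X0 ≤ x 0 ∧ x 0 ≤ X1) ∧ (Y0 ≤ x 1 ∧ x 1 ≤ Y1)) :
    (∀ z : ℂ, 0 ≤ wind (fun t : ℝ =>
        Set.IccExtend zero_le_one ((w₁.append w₂.reverse).toCurve (meshPoint 1)) t - z)) ↔
      ∀ m k : ℤ, X0 ≤ m → m < X1 → Y0 ≤ k → k < Y1 → wcross m k w₁ ≤ wcross m k w₂ := by
  constructor
  · intro h m k _ _ _ hk
    exact wcross_le_of_wind_nonneg hG w₁ w₂ hk.le (fun x hx => (hb₁ x hx).2.2)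
      (fun x hx => (hb₂ x hx).2.2) (h (probeL m k))
  · intro h z
    set w := w₁.append w₂.reverse with hwdef
    simp only [iccExtend_toCurve_apply]
    set P := poly a w.support.tail with hP
    have hsupp : ∀ x ∈ w.support, (X0 ≤ x 0 ∧ x 0 ≤ X1) ∧ (Y0 ≤ x 1 ∧ x 1 ≤ Y1) := by
      intro x hx
      rw [hwdef, SimpleGraph.Walk.mem_support_append_iff, SimpleGraph.Walk.support_reverse,
        List.mem_reverse] at hx
      rcases hx with hx | hx
      exacts [hb₁ x hx, hb₂ x hx]
    have hsupp' : ∀ x ∈ a :: w.support.tail, (X0 ≤ x 0 ∧ x 0 ≤ X1) ∧ (Y0 ≤ x 1 ∧ x 1 ≤ Y1) := by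
      rw [w.cons_tail_support]; exact hsupp
    have hchain := isChain_support hG w
    have hend := poly_fst_walk w
    by_cases hz : z ∈ range P
    · rw [wind_eq_zero_of_mem_range P hz]
    set m := ⌊z.re⌋ with hm
    set k := ⌊z.im⌋ with hk
    -- the segment from `z` to the face centre misses the trace
    have hseg : segment ℝ (probeL m k) z ⊆ (range P)ᶜ := by
      rw [segment_symm, ← insert_endpoints_openSegment]
      rintro y (rfl | rfl | hy)
      · exact hz
      · exact probeL_not_mem_range_poly m k hchain
      · intro hyP
        have hyF := openSegment_subset_openFace (Int.floor_le z.re) (Int.lt_floor_add_one z.re).le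
          (Int.floor_le z.im) (Int.lt_floor_add_one z.im).le hy
        exact not_int_of_mem_openFace hyF (exists_int_of_mem_range_poly a _ hchain y hyP)
    have hK : IsClosed (range P) := (isCompact_range P.continuous).isClosed
    have hcc : z ∈ connectedComponentIn (range P)ᶜ (probeL m k) :=
      (convex_segment _ _).isPreconnected.subset_connectedComponentIn (left_mem_segment _ _ _) hseg
        (right_mem_segment _ _ _)
    have h01 : P.extend 0 = P.extend 1 := by rw [Path.extend_zero, Path.extend_one, hend]
    have hzw := wind_sub_eq_of_mem_connectedComponentIn P.continuous_extend.continuousOn h01 hK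
      (fun t ht => by rw [Path.extend_apply P ht]; exact ⟨_, rfl⟩) hcc
    rw [← hzw]
    by_cases hin : X0 ≤ m ∧ m < X1 ∧ Y0 ≤ k ∧ k < Y1
    · obtain ⟨h1, h2, h3, h4⟩ := hin
      have key := wind_poly_probeL (m := m) h4.le a w.support.tail hchain
        (hsupp a w.start_mem_support).2.2 (fun x hx => (hsupp x (List.mem_of_mem_tail hx)).2.2) hend
      have key' : wind (fun t => P.extend t - probeL m k) = -wcross m k w := by
        unfold wcross; exact_mod_cast key
      rw [key', hwdef, wcross_append, wcross_reverse]
      have := h m k h1 h2 h3 h4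
      omega
    · have hmk : m < X0 ∨ X1 ≤ m ∨ k < Y0 ∨ Y1 ≤ k := by omega
      rw [wind_poly_probeL_eq_zero_of_not_mem a w.support.tail hend hsupp' hmk]

end OrderCharacterisation

end Summit.CriticalPhenomena.SAWScalingLimit.Theorems.LeftRightFKG.Negative
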